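import Summits.CriticalPhenomena.PercolationContinuityZ3.Theorems.Transplant.GridCoverRigidity
import HarnessLib

/-!
# Grid-covering rigidity, II: packaged SQUARES and HEXAGONS through degree-`≤ 4` vertices, and PERIODIC NETS ON `ℤ³` GIVEN BY A BOND TABLE
# (the common infrastructure of the `nbo` and sodalite method-void certificates)

builds on p205010 (kernel theorem, internal audit signed; external expert review pending) — nothing in this file uses p205010.
Lane `prim-bschramm`, seat `prim-bschramm-p4` (gen 19; PART C3, `HOME/bschramm/P4-GENERAL.md` §41).  Helper file
(`--supports stmt-CriticalPhenomena-4575 --as helper`).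

* §1 `GridSquare G` / `GridHexagon G`: a 4-cycle / a closed 6-walk without immediate returns, through vertices of degree `≤ 4`, as ONE term;
  `GridSquare.codes`, `GridHexagon.codes` restate the square law and the hexagon antipodality + rectangle law of `GridCoverRigidity` for them.
* §1b `false_of_heptagon` / `GridHeptagon`: the odd-ring form of p2's coordinate-sum parity (a unit-step chart makes the graph bipartite around
  degree-`≤ 4` vertices; used for the crossed-rows net `Cay(ℤ² ⋊_A ℤ; t, g)`, `A` of order 3, file `CrossedRowsNoSkeleton`);
* §2 `TableNet.graph k bonds`: the graph on `ℤ³` in which the bonds issuing from `x` are read off a table indexed by the class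
  `x₂ mod (k+1)` — the format of p2's `Hcp.hcpGraph` (`k+1 = 2`), of `Lon.graph` (`4`), and of the `nbo` (`3`) and sodalite (`6`) models of the
  companion files.  Unconditionally locally finite; under the two DECIDABLE table axioms (no zero bond; the reverse of a bond from class `c` is a
  bond from class `c + v₂`) adjacency is membership in the table (`TableNet.adj_iff`) and the degree is the row length (`TableNet.degree_eq`).
Everything here is [folklore]; the interfaces served are those of [cite: KozmaNitzan2024, §4 p. 15 (outward steps), p. 16 (Lemma 8)].
-/

namespace Summit.CriticalPhenomena.PercolationContinuityZ3.Theorems.Transplant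

open Literature.Probability.Percolation Literature.Probability.LatticeModels SimpleGraph GridCover
open scoped Classical

/-! ## §1 Squares and hexagons as single terms -/

section Rings

variable {V : Type} {G : SimpleGraph V} [G.LocallyFinite]

/-- **A square through vertices of degree `≤ 4`**: `v₀ v₁ v₂ v₃` consecutive neighbours with `v₀ ≠ v₂`, `v₁ ≠ v₃`. [folklore] -/
structure GridSquare (G : SimpleGraph V) [G.LocallyFinite] where
  /-- the four vertices in cyclic order -/
  (v₀ v₁ v₂ v₃ : V)
  (h₀₁ : G.Adj v₀ v₁) (h₁₂ : G.Adj v₁ v₂) (h₂₃ : G.Adj v₂ v₃) (h₃₀ : G.Adj v₃ v₀)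
  (n₀₂ : v₀ ≠ v₂) (n₁₃ : v₁ ≠ v₃)
  (d₀ : G.degree v₀ ≤ 4) (d₁ : G.degree v₁ ≤ 4) (d₂ : G.degree v₂ ≤ 4) (d₃ : G.degree v₃ ≤ 4)

/-- **The square law** for a `GridSquare`: codes `k₀ … k₃` of the four steps with `k₂ = opp k₀`, `k₃ = opp k₁`, `axis k₁ ≠ axis k₀`. [folklore] -/
theorem GridSquare.codes (S : GridSquare G) {φ : V → Site 2}
    (hstep : ∀ (v : V) (i : Fin 2) (σ : ℤˣ), ∃ v' : V, G.Adj v v' ∧ φ v' = φ v + Pi.single i (σ : ℤ)) :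
    ∃ k₀ k₁ k₂ k₃ : Fin 4, φ S.v₁ - φ S.v₀ = vec k₀ ∧ φ S.v₂ - φ S.v₁ = vec k₁ ∧ φ S.v₃ - φ S.v₂ = vec k₂ ∧ φ S.v₀ - φ S.v₃ = vec k₃ ∧
      k₂ = opp k₀ ∧ k₃ = opp k₁ ∧ axis k₁ ≠ axis k₀ :=
  square_codes hstep S.h₀₁ S.h₁₂ S.h₂₃ S.h₃₀ S.n₀₂ S.n₁₃ S.d₀ S.d₁ S.d₂ S.d₃

/-- **A hexagon through vertices of degree `≤ 4`**: a closed walk `v₀ … v₅` with `v_{i+2} ≠ v_i`. [folklore] -/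
structure GridHexagon (G : SimpleGraph V) [G.LocallyFinite] where
  /-- the six vertices in cyclic order -/
  (v₀ v₁ v₂ v₃ v₄ v₅ : V)
  (h₀₁ : G.Adj v₀ v₁) (h₁₂ : G.Adj v₁ v₂) (h₂₃ : G.Adj v₂ v₃) (h₃₄ : G.Adj v₃ v₄) (h₄₅ : G.Adj v₄ v₅) (h₅₀ : G.Adj v₅ v₀)
  (n₀₂ : v₀ ≠ v₂) (n₁₃ : v₁ ≠ v₃) (n₂₄ : v₂ ≠ v₄) (n₃₅ : v₃ ≠ v₅) (n₄₀ : v₄ ≠ v₀) (n₅₁ : v₅ ≠ v₁)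
  (d₀ : G.degree v₀ ≤ 4) (d₁ : G.degree v₁ ≤ 4) (d₂ : G.degree v₂ ≤ 4) (d₃ : G.degree v₃ ≤ 4) (d₄ : G.degree v₄ ≤ 4)
  (d₅ : G.degree v₅ ≤ 4)

/-- **Hexagon antipodality + rectangle law** for a `GridHexagon`. [folklore] -/
theorem GridHexagon.codes (H : GridHexagon G) {φ : V → Site 2}
    (hstep : ∀ (v : V) (i : Fin 2) (σ : ℤˣ), ∃ v' : V, G.Adj v v' ∧ φ v' = φ v + Pi.single i (σ : ℤ)) :
    ∃ k₀ k₁ k₂ k₃ k₄ k₅ : Fin 4, φ H.v₁ - φ H.v₀ = vec k₀ ∧ φ H.v₂ - φ H.v₁ = vec k₁ ∧ φ H.v₃ - φ H.v₂ = vec k₂ ∧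
      φ H.v₄ - φ H.v₃ = vec k₃ ∧ φ H.v₅ - φ H.v₄ = vec k₄ ∧ φ H.v₀ - φ H.v₅ = vec k₅ ∧ (k₃ = opp k₀ ∧ k₄ = opp k₁ ∧ k₅ = opp k₂) ∧
      ((k₁ = k₂ ∧ axis k₀ ≠ axis k₁) ∨ (k₀ = k₁ ∧ axis k₂ ≠ axis k₀) ∨ (k₂ = opp k₀ ∧ axis k₁ ≠ axis k₀)) :=
  hexagon_codes hstep H.h₀₁ H.h₁₂ H.h₂₃ H.h₃₄ H.h₄₅ H.h₅₀ H.n₀₂ H.n₁₃ H.n₂₄ H.n₃₅ H.n₄₀ H.n₅₁ H.d₀ H.d₁ H.d₂ H.d₃ H.d₄ H.d₅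

/-- **The rectangle law as a Boolean test** on the first three step codes of a hexagon (`decide`-friendly normal form). [folklore] -/
def GridCover.rect (x y z : Fin 4) : Bool :=
  (y == z && axis x != axis y) || (x == y && axis z != axis x) || (z == opp x && axis y != axis x)

/-- The propositional rectangle law implies the Boolean one. [folklore] -/
theorem GridCover.rect_of_pattern : ∀ {x y z : Fin 4},
    ((y = z ∧ axis x ≠ axis y) ∨ (x = y ∧ axis z ≠ axis x) ∨ (z = opp x ∧ axis y ≠ axis x)) → GridCover.rect x y z = true := by
  decide

/-- **The rectangle law of a `GridHexagon` in Boolean form**, with the codes of its first three darts and of the three reversed closing darts.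
[folklore] -/
theorem GridHexagon.rect (H : GridHexagon G) {φ : V → Site 2}
    (hstep : ∀ (v : V) (i : Fin 2) (σ : ℤˣ), ∃ v' : V, G.Adj v v' ∧ φ v' = φ v + Pi.single i (σ : ℤ)) :
    ∃ k₀ k₁ k₂ : Fin 4, φ H.v₁ - φ H.v₀ = vec k₀ ∧ φ H.v₂ - φ H.v₁ = vec k₁ ∧ φ H.v₃ - φ H.v₂ = vec k₂ ∧
      φ H.v₄ - φ H.v₃ = vec (opp k₀) ∧ φ H.v₅ - φ H.v₄ = vec (opp k₁) ∧ φ H.v₀ - φ H.v₅ = vec (opp k₂) ∧ GridCover.rect k₀ k₁ k₂ = true := by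
  obtain ⟨k₀, k₁, k₂, k₃, k₄, k₅, h₀, h₁, h₂, h₃, h₄, h₅, ⟨e₃, e₄, e₅⟩, hp⟩ := H.codes hstep
  exact ⟨k₀, k₁, k₂, h₀, h₁, h₂, e₃ ▸ h₃, e₄ ▸ h₄, e₅ ▸ h₅, GridCover.rect_of_pattern hp⟩

/-- `opp` is injective. [folklore] -/
theorem GridCover.opp_injective : ∀ {a b : Fin 4}, opp a = opp b → a = b := by decide

/-- `opp` is an involution. [folklore] -/
@[simp] theorem GridCover.opp_opp : ∀ a : Fin 4, opp (opp a) = a := by decide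

/-- Two codes of the SAME dart agree. [folklore] -/
theorem code_unique {φ : V → Site 2} {u v : V} {k k' : Fin 4} (h : φ v - φ u = vec k) (h' : φ v - φ u = vec k') : k = k' :=
  vec_injective (h.symm.trans h')

/-- The code of the reversed dart is the opposite code. [folklore] -/
theorem code_reverse {φ : V → Site 2} {u v : V} {k k' : Fin 4} (h : φ v - φ u = vec k) (h' : φ u - φ v = vec k') : k' = opp k :=
  vec_injective (by rw [← h', vec_opp, ← h, neg_sub])

/-- Darts from one vertex of degree `≤ 4` to two different neighbours have different codes. [folklore] -/
theorem code_ne_of_ne {φ : V → Site 2}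
    (hstep : ∀ (v : V) (i : Fin 2) (σ : ℤˣ), ∃ v' : V, G.Adj v v' ∧ φ v' = φ v + Pi.single i (σ : ℤ))
    {v u u' : V} (hv : G.degree v ≤ 4) (hu : G.Adj v u) (hu' : G.Adj v u') (hne : u ≠ u') {k k' : Fin 4}
    (hk : φ u - φ v = vec k) (hk' : φ u' - φ v = vec k') : k ≠ k' := by
  intro e
  subst e
  exact hne (label_injective hstep hv hu hu' (sub_left_injective (hk.trans hk'.symm)))

/-- **THE ODD-RING OBSTRUCTION** (p2's coordinate-sum parity, from triangles to heptagons): along every bond at a vertex of degree `≤ 4` the sum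
`φ₀ + φ₁` changes by `±1`, so no closed walk of length `7` runs through vertices of degree `≤ 4` — a unit-step chart makes the graph locally bipartite.
[folklore] -/
theorem false_of_heptagon {φ : V → Site 2}
    (hstep : ∀ (v : V) (i : Fin 2) (σ : ℤˣ), ∃ v' : V, G.Adj v v' ∧ φ v' = φ v + Pi.single i (σ : ℤ))
    {v₀ v₁ v₂ v₃ v₄ v₅ v₆ : V} (h₀₁ : G.Adj v₀ v₁) (h₁₂ : G.Adj v₁ v₂) (h₂₃ : G.Adj v₂ v₃) (h₃₄ : G.Adj v₃ v₄) (h₄₅ : G.Adj v₄ v₅)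
    (h₅₆ : G.Adj v₅ v₆) (h₆₀ : G.Adj v₆ v₀)
    (d₀ : G.degree v₀ ≤ 4) (d₁ : G.degree v₁ ≤ 4) (d₂ : G.degree v₂ ≤ 4) (d₃ : G.degree v₃ ≤ 4) (d₄ : G.degree v₄ ≤ 4)
    (d₅ : G.degree v₅ ≤ 4) (d₆ : G.degree v₆ ≤ 4) : False := by
  have e₀ := coordSum_step_of_degree_le hstep d₀ h₀₁
  have e₁ := coordSum_step_of_degree_le hstep d₁ h₁₂
  have e₂ := coordSum_step_of_degree_le hstep d₂ h₂₃
  have e₃ := coordSum_step_of_degree_le hstep d₃ h₃₄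
  have e₄ := coordSum_step_of_degree_le hstep d₄ h₄₅
  have e₅ := coordSum_step_of_degree_le hstep d₅ h₅₆
  have e₆ := coordSum_step_of_degree_le hstep d₆ h₆₀
  omega

/-- **A heptagon through vertices of degree `≤ 4`** as one term. [folklore] -/
structure GridHeptagon (G : SimpleGraph V) [G.LocallyFinite] where
  /-- the seven vertices in cyclic order -/
  (v₀ v₁ v₂ v₃ v₄ v₅ v₆ : V)
  (h₀₁ : G.Adj v₀ v₁) (h₁₂ : G.Adj v₁ v₂) (h₂₃ : G.Adj v₂ v₃) (h₃₄ : G.Adj v₃ v₄) (h₄₅ : G.Adj v₄ v₅) (h₅₆ : G.Adj v₅ v₆) (h₆₀ : G.Adj v₆ v₀)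
  (d₀ : G.degree v₀ ≤ 4) (d₁ : G.degree v₁ ≤ 4) (d₂ : G.degree v₂ ≤ 4) (d₃ : G.degree v₃ ≤ 4) (d₄ : G.degree v₄ ≤ 4)
  (d₅ : G.degree v₅ ≤ 4) (d₆ : G.degree v₆ ≤ 4)

/-- A heptagon through degree-`≤ 4` vertices excludes the field (ι). [folklore] -/
theorem GridHeptagon.false_of_unitSteps (H : GridHeptagon G) {φ : V → Site 2}
    (hstep : ∀ (v : V) (i : Fin 2) (σ : ℤˣ), ∃ v' : V, G.Adj v v' ∧ φ v' = φ v + Pi.single i (σ : ℤ)) : False :=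
  false_of_heptagon hstep H.h₀₁ H.h₁₂ H.h₂₃ H.h₃₄ H.h₄₅ H.h₅₆ H.h₆₀ H.d₀ H.d₁ H.d₂ H.d₃ H.d₄ H.d₅ H.d₆

end Rings

/-! ## §2 Periodic nets on `ℤ³` from a bond table indexed by `x₂ mod (k+1)` -/

namespace TableNet

/-- The class of a site: `x₂ mod (k+1)`, as an element of `Fin (k+1)`. [folklore] -/
def cls (k : ℕ) (x : Site 3) : Fin (k + 1) :=
  ⟨(x 2 % (k + 1 : ℕ)).toNat, by
    have h0 : 0 ≤ x 2 % (k + 1 : ℕ) := Int.emod_nonneg _ (by positivity)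
    have h1 : x 2 % (k + 1 : ℕ) < (k + 1 : ℕ) := Int.emod_lt_of_pos _ (by positivity)
    omega⟩

/-- The class of the far end of a bond `v` from a class-`c` site: `c + v₂ mod (k+1)`. [folklore] -/
def tgt (k : ℕ) (c : Fin (k + 1)) (v : Site 3) : Fin (k + 1) :=
  ⟨((((c : ℕ) : ℤ) + v 2) % (k + 1 : ℕ)).toNat, by
    have h0 : 0 ≤ (((c : ℕ) : ℤ) + v 2) % (k + 1 : ℕ) := Int.emod_nonneg _ (by positivity)
    have h1 : (((c : ℕ) : ℤ) + v 2) % (k + 1 : ℕ) < (k + 1 : ℕ) := Int.emod_lt_of_pos _ (by positivity)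
    omega⟩

/-- The class as an integer. [folklore] -/
theorem cls_val (k : ℕ) (x : Site 3) : ((cls k x : ℕ) : ℤ) = x 2 % (k + 1 : ℕ) := by
  have h0 : 0 ≤ x 2 % (k + 1 : ℕ) := Int.emod_nonneg _ (by positivity)
  show (((x 2 % (k + 1 : ℕ)).toNat : ℕ) : ℤ) = _
  omega

/-- **The class of the far end of a bond.** [folklore] -/
theorem cls_add (k : ℕ) (x v : Site 3) : cls k (x + v) = tgt k (cls k x) v := by
  apply Fin.ext
  show (((x + v) 2 % (k + 1 : ℕ)).toNat) = ((((cls k x : ℕ) : ℤ) + v 2) % (k + 1 : ℕ)).toNat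
  rw [cls_val, Pi.add_apply, Int.emod_add_emod]

/-- **The net defined by a bond table.** [folklore] -/
def graph (k : ℕ) (bonds : Fin (k + 1) → Finset (Site 3)) : SimpleGraph (Site 3) :=
  SimpleGraph.fromRel fun x y => y - x ∈ bonds (cls k x)

variable {k : ℕ} {bonds : Fin (k + 1) → Finset (Site 3)}

/-- The neighbours of `x` lie in a finite set read off the table (no table axiom needed). [folklore] -/
theorem neighborSet_subset (x : Site 3) :
    (graph k bonds).neighborSet x ⊆
      ↑((bonds (cls k x)).image (x + ·) ∪ (Finset.univ : Finset (Fin (k + 1))).biUnion fun c => (bonds c).image (x - ·)) := by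
  intro y hy
  rw [SimpleGraph.mem_neighborSet, graph, SimpleGraph.fromRel_adj] at hy
  obtain ⟨-, h | h⟩ := hy
  · rw [Finset.coe_union]
    exact Or.inl (by rw [Finset.coe_image]; exact ⟨y - x, h, by simp⟩)
  · rw [Finset.coe_union]
    refine Or.inr ?_
    rw [Finset.mem_coe, Finset.mem_biUnion]
    exact ⟨cls k y, Finset.mem_univ _, Finset.mem_image.2 ⟨x - y, h, by abel⟩⟩

/-- The net is locally finite. [folklore] -/
noncomputable instance graph_locallyFinite : (graph k bonds).LocallyFinite := fun x =>
  ((Finset.finite_toSet _).subset (neighborSet_subset x)).fintype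

/-- **Adjacency is membership in the table**, given the two table axioms (no zero bond; reverse bonds are bonds). [folklore] -/
theorem adj_iff (h0 : ∀ c, (0 : Site 3) ∉ bonds c) (hsymm : ∀ c, ∀ v ∈ bonds c, -v ∈ bonds (tgt k c v)) (x y : Site 3) :
    (graph k bonds).Adj x y ↔ y - x ∈ bonds (cls k x) := by
  rw [graph, SimpleGraph.fromRel_adj]
  constructor
  · rintro ⟨-, h | h⟩
    · exact h
    · have h' := hsymm _ _ h
      rw [neg_sub, ← cls_add, add_sub_cancel] at h'
      exact h'
  · intro h
    refine ⟨fun hxy => h0 (cls k x) ?_, Or.inl h⟩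
    subst hxy
    rwa [sub_self] at h

/-- A table bond gives an edge (only the no-zero-bond axiom is needed). [folklore] -/
theorem adj_of_mem (h0 : ∀ c, (0 : Site 3) ∉ bonds c) {x y : Site 3} (h : y - x ∈ bonds (cls k x)) : (graph k bonds).Adj x y := by
  rw [graph, SimpleGraph.fromRel_adj]
  refine ⟨fun hxy => h0 (cls k x) ?_, Or.inl h⟩
  subst hxy
  rwa [sub_self] at h

/-- The neighbour finset is the image of the table row. [folklore] -/
theorem neighborFinset_eq (h0 : ∀ c, (0 : Site 3) ∉ bonds c) (hsymm : ∀ c, ∀ v ∈ bonds c, -v ∈ bonds (tgt k c v)) (x : Site 3) :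
    (graph k bonds).neighborFinset x = (bonds (cls k x)).image (x + ·) := by
  ext y
  rw [SimpleGraph.mem_neighborFinset, adj_iff h0 hsymm, Finset.mem_image]
  constructor
  · intro h; exact ⟨y - x, h, by abel⟩
  · rintro ⟨s, hs, rfl⟩; simpa using hs

/-- **The degree is the row length** of the table. [folklore] -/
theorem degree_eq (h0 : ∀ c, (0 : Site 3) ∉ bonds c) (hsymm : ∀ c, ∀ v ∈ bonds c, -v ∈ bonds (tgt k c v)) {d : ℕ}
    (hcard : ∀ c, (bonds c).card = d) (x : Site 3) : (graph k bonds).degree x = d := by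
  rw [← SimpleGraph.card_neighborFinset_eq_degree, neighborFinset_eq h0 hsymm, Finset.card_image_of_injective _ (add_right_injective x),
    hcard]

/-- The class is invariant under translations by vectors whose third coordinate is divisible by `k+1`. [folklore] -/
theorem cls_add_of_dvd (x u : Site 3) (hu : ((k + 1 : ℕ) : ℤ) ∣ u 2) : cls k (x + u) = cls k x := by
  apply Fin.ext
  show ((x + u) 2 % (k + 1 : ℕ)).toNat = (x 2 % (k + 1 : ℕ)).toNat
  have h0 : u 2 % ((k + 1 : ℕ) : ℤ) = 0 := Int.emod_eq_zero_of_dvd hu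
  rw [Pi.add_apply, Int.add_emod, h0, add_zero, Int.emod_emod]

/-- **Lattice translations are automorphisms** of a table net (translation by `u` with `(k+1) ∣ u₂`). [folklore] -/
def addIso (u : Site 3) (hu : ((k + 1 : ℕ) : ℤ) ∣ u 2) : graph k bonds ≃g graph k bonds where
  toEquiv := Equiv.addRight u
  map_rel_iff' := by
    intro a b
    show (graph k bonds).Adj (a + u) (b + u) ↔ (graph k bonds).Adj a b
    simp only [graph, SimpleGraph.fromRel_adj, add_sub_add_right_eq_sub, cls_add_of_dvd _ u hu, ne_eq, add_left_inj]

/-- `addIso u` is translation by `u`. [folklore] -/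
@[simp] theorem addIso_apply (u : Site 3) (hu : ((k + 1 : ℕ) : ℤ) ∣ u 2) (x : Site 3) : addIso (bonds := bonds) u hu x = x + u := rfl

end TableNet

end Summit.CriticalPhenomena.PercolationContinuityZ3.Theorems.Transplant
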